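import Summits.QuantumAdvantage.AdviceFreeQNC0.GaugeCount
import Summits.QuantumAdvantage.AdviceFreeQNC0.BlockParityTarget
import HarnessLib

/-!
# Cell qa-qnc0 (rung F-Q2-odd, `p = 3`): the structured inputs and Smolensky's endgame (ROUND-15 §3.5–3.6)

Planner qa-qnc0-p1 g16, `ROUND-15.md` §3.5–§3.6 (formalisation map L5–L6), for THEOREM A′ `PredHardDWB3`.  The
structured pattern `Sx y c` glues the structured window word of `StructuredWord.lean` (`K` parity gadgets of length
`6ℓ+1` driven by the blocks of `c ∈ {0,1}^{Kℓ}`, then a filler realising `affP b τ`) into the outside content `y`.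
PROVED:
* `Pwin_Sx` — its window word is `affP b (κ₀·Σ_j gsign_j(c) + τ)` with `gsign_j(c) = (−1)^{p_j(c)}` (`gsign_cbOf`);
* `dk3_Sx` — its stake is `t₀(y) + Σ_j η(y)·(−1)^{p_j(c)}` = `BlockParity.target` with `η = sgnW_prefix·κ₀ ≠ 0`;
* `comp_Sx_mem_lowDeg` — `c ↦ Sx y c` has coordinate degree `≤ 1` (every bit is a constant or a negated input bit);
* `card_structured_le` — hence for every lift randomness `r`, LEMMA S (`BlockParity.card_agree_target_le`) bounds
  `#{c : g(Ψ_r(Sx y c)) = D_k(Ψ_r(Sx y c))}` by `2^{Kℓ}(1/3 + (2/3)2^{−K} + 6·2^K·ΔL/√ℓ)`;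
* **`sum_Vsum_affP_le`** — averaging over `r` (identity (T), `sum_psi_eq`) and over the base translation `τ ∈ 𝔽₃`:
  `Σ_{t} V c₁ y (affP b t) ≤ 6^m·(1 + 2·2^{−K} + 18·2^K·ΔL/√ℓ)` for the indicator `c₁` of "`g` predicts `D_k`".

WHAT THIS IS NOT: the parameter choice closing `PredHardDWB3` is the next (last) file; separation NOT moved.
-/

noncomputable section

namespace Summit.QuantumAdvantage.AdviceFreeQNC0

namespace DWalk

open Finset Equiv
open Literature.Computability.MetaComplexity Literature.Computability.MetaComplexity.Smolensky

section StructuredBound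

variable {n : ℕ} {a L m : ℕ} {κ₀ : ZMod 3} {k : ℕ} {K ℓ : ℕ} {Lf : ℕ}

/-- The gadget sign of block `j` is `(−1)^{p_j(c)}`. -/
theorem gsign_cbOf (c : Fin (K * ℓ) → Bool) (j : Fin K) :
    gsign ℓ (cbOf K ℓ c j.val) = if BlockParity.bpar (ℓ := ℓ) c j = true then -1 else 1 := by
  rw [gsign_eq_ite]
  have hset : (univ.filter fun i : Fin ℓ => cbOf K ℓ c j.val i = true).card =
      ((BlockParity.block (ℓ := ℓ) j).filter fun i => c i = true).card := by
    unfold BlockParity.block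
    rw [Finset.filter_image, Finset.card_image_of_injective _ (BlockParity.idx_injective j)]
    congr 1; ext i; simp [cbOf, j.isLt]
  rw [hset]
  simp only [BlockParity.bpar, decide_eq_true_eq]

/-- Reading the structured window back from the structured pattern. -/
theorem xN_Sx (haW : a + (m + 1) * L ≤ n) (fb : Fin Lf → Bool) (y : Fin (n + 1) → Bool) (c : Fin (K * ℓ) → Bool)
    {t : ℕ} (ht : t < (m + 1) * L) : xN (Sx a L m K ℓ fb y c) (a + t) = sword ℓ K (cbOf K ℓ c) fb t := by
  unfold Sx xN
  rw [dif_pos (by omega), glue_apply_of_mem y _ (by simp; omega)]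
  simp [swin]

/-- **The window word of the structured pattern** is `affP b (κ₀·Σ_j gsign_j + τ)`. -/
theorem isAff_Pwin_Sx (hκ0 : KappaConst a L m κ₀ k) (haW : a + (m + 1) * L ≤ n) (hW : (m + 1) * L = K * (6 * ℓ + 1) + Lf)
    {fb : Fin Lf → Bool} {b : Bool} {τ : ZMod 3} (hfb : fb ∈ fib κ₀ Lf (affP b τ)) (y : Fin (n + 1) → Bool)
    (c : Fin (K * ℓ) → Bool) :
    IsAff (Pwin a L m κ₀ (Sx a L m K ℓ fb y c)) (yt b) (κ₀ * (∑ j ∈ range K, gsign ℓ (cbOf K ℓ c j)) + τ) := by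
  rw [Pwin_eq_wp hκ0, wp_congr (κ' := fun _ => κ₀) (x' := sword ℓ K (cbOf K ℓ c) fb) (a' := 0)
    (fun t ht => ⟨hκ0 _ (by omega) (by omega), by rw [Nat.zero_add]; exact xN_Sx haW fb y c ht⟩), hW]
  have hfb' : IsAff (blockPerm κ₀ fb) (yt b) τ := by rw [(mem_fib_iff _ _).1 hfb]; exact isAff_affP b τ
  exact isAff_sword ℓ K (cbOf K ℓ c) fb hfb'

/-- As a permutation: `Pwin (Sx y c) = affP b (κ₀·Σσ + τ)`. -/
theorem Pwin_Sx (hκ0 : KappaConst a L m κ₀ k) (haW : a + (m + 1) * L ≤ n) (hW : (m + 1) * L = K * (6 * ℓ + 1) + Lf)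
    {fb : Fin Lf → Bool} {b : Bool} {τ : ZMod 3} (hfb : fb ∈ fib κ₀ Lf (affP b τ)) (y : Fin (n + 1) → Bool)
    (c : Fin (K * ℓ) → Bool) :
    Pwin a L m κ₀ (Sx a L m K ℓ fb y c) = affP b (κ₀ * (∑ j ∈ range K, gsign ℓ (cbOf K ℓ c j)) + τ) :=
  (isAff_Pwin_Sx hκ0 haW hW hfb y c).perm_eq (isAff_affP _ _)

/-- The coefficient is non-zero. -/
theorem etaOf_ne_zero (hκ0 : κ₀ ≠ 0) (y : Fin (n + 1) → Bool) : etaOf a κ₀ y ≠ 0 := by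
  unfold etaOf
  rcases sgnW_eq_or (xN y) 0 a with h | h <;> rw [h]
  · simpa using hκ0
  · have : ∀ c : ZMod 3, c ≠ 0 → -1 * c ≠ 0 := by decide
    exact this κ₀ hκ0

/-- **The stake of the structured pattern is the block-parity target**:
`D_k(Sx y c) = t₀(y) + Σ_j η(y)·(−1)^{p_j(c)}`. -/
theorem dk3_Sx (hκ0 : KappaConst a L m κ₀ k) (haW : a + (m + 1) * L ≤ n) (hk : k ≤ n)
    (hW : (m + 1) * L = K * (6 * ℓ + 1) + Lf) {fb : Fin Lf → Bool} {b : Bool} {τ : ZMod 3}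
    (hfb : fb ∈ fib κ₀ Lf (affP b τ)) (y : Fin (n + 1) → Bool) (c : Fin (K * ℓ) → Bool) :
    Dk3 (Sx a L m K ℓ fb y c) k = BlockParity.target (t0Of a L m k n b τ y) (fun _ => etaOf a κ₀ y) c := by
  set x := Sx a L m K ℓ fb y c with hx
  rw [dk3_eq_trW x hk, trW_window (kappa k) (xN x) haW]
  -- outside data agree with those of `y`
  have hout : ∀ i, ¬ (a ≤ i ∧ i < a + (m + 1) * L) → xN x i = xN y i := fun i hi => xN_glue_of_not_mem y _ hi
  have h1 : trW (kappa k) (xN x) 0 a = trW (kappa k) (xN y) 0 a :=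
    trW_congr fun t ht => ⟨rfl, by rw [Nat.zero_add]; exact hout t (by omega)⟩
  have h2 : sgnW (xN x) 0 a = sgnW (xN y) 0 a := sgnW_congr fun t ht => by rw [Nat.zero_add]; exact hout t (by omega)
  have h3 : trW (kappa k) (xN x) (a + (m + 1) * L) (n - (a + (m + 1) * L)) =
      trW (kappa k) (xN y) (a + (m + 1) * L) (n - (a + (m + 1) * L)) := trW_congr fun t _ => ⟨rfl, hout _ (by omega)⟩
  -- window data are the affine data of the structured window word
  have hwin := isAff_Pwin_Sx hκ0 haW hW hfb y c
  rw [Pwin_eq_wp hκ0] at hwin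
  have hu := (isAff_wp (kappa k) (xN x) a ((m + 1) * L)).unique hwin
  rw [h1, h2, h3, hu.1, hu.2]
  unfold BlockParity.target BlockParity.tau t0Of etaOf
  rw [← Fin.sum_univ_eq_sum_range (fun j => gsign ℓ (cbOf K ℓ c j)) K]
  simp only [gsign_cbOf]
  rw [← Finset.mul_sum]
  ring

/-! ### The structured embedding has coordinate degree `≤ 1` -/

/-- **`c ↦ G(Sx y c)` has degree `≤ D`** for `G` of degree `≤ D`. -/
theorem comp_Sx_mem_lowDeg (fb : Fin Lf → Bool) (y : Fin (n + 1) → Bool) {D : ℕ} {G : CubeFn (ZMod 3) (n + 1)}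
    (hG : G ∈ lowDeg (ZMod 3) (n + 1) D) :
    (fun c => G (Sx a L m K ℓ fb y c)) ∈ lowDeg (ZMod 3) (K * ℓ) D := by
  refine comp_mem_lowDeg_of_coord (Sx a L m K ℓ fb y) (fun i => ?_) hG
  -- a constant coordinate has an indicator of degree 0
  have hconst : ∀ b₀ : Bool, (fun _ : Fin (K * ℓ) → Bool => if b₀ = true then (1 : ZMod 3) else 0) ∈
      lowDeg (ZMod 3) (K * ℓ) 1 := by
    intro b₀; cases b₀
    · have : (fun _ : Fin (K * ℓ) → Bool => if false = true then (1 : ZMod 3) else 0) = 0 := by funext; simp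
      rw [this]; exact Submodule.zero_mem _
    · have : (fun _ : Fin (K * ℓ) → Bool => if true = true then (1 : ZMod 3) else 0) = 1 := by funext; simp
      rw [this]; exact one_mem_lowDeg 1
  by_cases hi : a ≤ i.val ∧ i.val < a + (m + 1) * L
  · have heq : ∀ c, Sx a L m K ℓ fb y c i = sword ℓ K (cbOf K ℓ c) fb (i.val - a) := by
      intro c; unfold Sx; rw [glue_apply_of_mem y _ hi]; rfl
    simp only [heq]
    rcases sword_shape ℓ K fb (i.val - a) with ⟨b₀, hb⟩ | ⟨hlt, i', hi'⟩
    · simp only [hb]; exact hconst b₀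
    · simp only [hi']
      have hj : (i.val - a) / (6 * ℓ + 1) < K := Nat.div_lt_of_lt_mul (by rw [Nat.mul_comm]; exact hlt)
      have hbit : ∀ c : Fin (K * ℓ) → Bool, cbOf K ℓ c ((i.val - a) / (6 * ℓ + 1)) i' =
          c (BlockParity.idx ⟨_, hj⟩ i') := fun c => by simp [cbOf, hj]
      simp only [hbit]
      have : (fun c : Fin (K * ℓ) → Bool => if (!c (BlockParity.idx ⟨_, hj⟩ i')) = true then (1 : ZMod 3) else 0) =
          1 - fun c => if c (BlockParity.idx ⟨_, hj⟩ i') = true then (1 : ZMod 3) else 0 := by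
        funext c; simp only [Pi.sub_apply, Pi.one_apply]; cases c (BlockParity.idx ⟨_, hj⟩ i') <;> simp
      rw [this]
      exact Submodule.sub_mem _ (one_mem_lowDeg 1) (bitFn_mem_lowDeg _ le_rfl)
  · have heq : ∀ c, Sx a L m K ℓ fb y c i = y i := fun c => by unfold Sx; rw [glue_apply_of_not_mem y _ hi]
    simp only [heq]; exact hconst (y i)

/-! ### Smolensky's endgame on the structured inputs -/

/-- **For every lift randomness**, `#{c : g(Ψ_r(Sx y c)) = D_k(Ψ_r(Sx y c))} ≤ 2^{Kℓ}(1/3 + (2/3)2^{−K} + 6·2^K·ΔL/√ℓ)`. -/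
theorem card_structured_le (hκ : κ₀ ≠ 0) (hκ0 : KappaConst a L m κ₀ k) (haW : a + (m + 1) * L ≤ n) (hk : k ≤ n)
    (hL : 1 ≤ L) (hℓ : 1 ≤ ℓ) (hW : (m + 1) * L = K * (6 * ℓ + 1) + Lf) {fb : Fin Lf → Bool} {b : Bool} {τ : ZMod 3}
    (hfb : fb ∈ fib κ₀ Lf (affP b τ)) (y : Fin (n + 1) → Bool) {Δ : ℕ} {g : CubeFn (ZMod 3) (n + 1)}
    (hg : g ∈ lowDeg (ZMod 3) (n + 1) Δ) (r : Rand L m κ₀) :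
    ((univ.filter fun c : Fin (K * ℓ) → Bool =>
        g (psi a L m κ₀ r (Sx a L m K ℓ fb y c)) = Dk3 (psi a L m κ₀ r (Sx a L m K ℓ fb y c)) k).card : ℝ) ≤
      (2 : ℝ) ^ (K * ℓ) * (1 / 3 + 2 / 3 / (2 : ℝ) ^ K + 6 * (2 : ℝ) ^ K * ((Δ * L : ℕ) : ℝ) / Real.sqrt ℓ) := by
  have hF : (fun c => g (psi a L m κ₀ r (Sx a L m K ℓ fb y c))) ∈ lowDeg (ZMod 3) (K * ℓ) (Δ * L) :=
    comp_Sx_mem_lowDeg fb y (comp_psi_mem_lowDeg haW hL r hg)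
  have h := BlockParity.card_agree_target_le hℓ (t0Of a L m k n b τ y) (fun _ => etaOf a κ₀ y)
    (fun _ => etaOf_ne_zero hκ y) hF
  refine le_trans (le_of_eq ?_) h
  congr 2; ext c
  simp only [mem_filter, mem_univ, true_and, dk3_psi hκ0 haW hk, dk3_Sx hκ0 haW hk hW hfb]

/-- Resampling tables exist (all fibres non-empty). -/
theorem card_Tbl_pos (hκ : κ₀ ≠ 0) (hL : 3 ≤ L) : 0 < Fintype.card (Tbl L m κ₀) := by
  have : Nonempty (Tbl L m κ₀) :=
    ⟨fun j g => ⟨(fib_nonempty hκ hL g).choose, (fib_nonempty hκ hL g).choose_spec⟩⟩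
  exact Fintype.card_pos

/-- **Structured side** (ROUND-15 §3.5–3.6): for the indicator `c₁` of "`g` predicts `D_k`" and every sign `b`,
`Σ_t V c₁ y (affP b t) ≤ 6^m·(1 + 2·2^{−K} + 18·2^K·ΔL/√ℓ)`. -/
theorem sum_Vsum_affP_le (hκ : κ₀ ≠ 0) (hκ0 : KappaConst a L m κ₀ k) (haW : a + (m + 1) * L ≤ n) (hk : k ≤ n)
    (hL : 3 ≤ L) (hℓ : 1 ≤ ℓ) (hLf : 3 ≤ Lf) (hW : (m + 1) * L = K * (6 * ℓ + 1) + Lf) (y : Fin (n + 1) → Bool)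
    {Δ : ℕ} {g : CubeFn (ZMod 3) (n + 1)} (hg : g ∈ lowDeg (ZMod 3) (n + 1) Δ) (b : Bool) :
    ∑ t : ZMod 3, Vsum a L m κ₀ (fun x => if g x = Dk3 x k then (1 : ℝ) else 0) y (affP b t) ≤
      (6 : ℝ) ^ m * (1 + 2 / (2 : ℝ) ^ K + 18 * (2 : ℝ) ^ K * ((Δ * L : ℕ) : ℝ) / Real.sqrt ℓ) := by
  set c₁ : (Fin (n + 1) → Bool) → ℝ := fun x => if g x = Dk3 x k then (1 : ℝ) else 0 with hc₁
  set B : ℝ := (2 : ℝ) ^ (K * ℓ) * (1 / 3 + 2 / 3 / (2 : ℝ) ^ K + 6 * (2 : ℝ) ^ K * ((Δ * L : ℕ) : ℝ) / Real.sqrt ℓ)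
    with hB
  have hT : (0 : ℝ) < Fintype.card (Tbl L m κ₀) := by exact_mod_cast card_Tbl_pos hκ hL
  -- for each base translation `τ`: sum over `c` and `r`
  have hτ : ∀ τ : ZMod 3,
      (∑ c : Fin (K * ℓ) → Bool, Vsum a L m κ₀ c₁ y (Pwin a L m κ₀ (Sx a L m K ℓ (fbOf hκ hLf b τ) y c))) *
        Fintype.card (Tbl L m κ₀) ≤ (Fintype.card (Rand L m κ₀) : ℝ) * B := by
    intro τ
    rw [Finset.sum_mul]
    have hx : ∀ c : Fin (K * ℓ) → Bool,
        Vsum a L m κ₀ c₁ y (Pwin a L m κ₀ (Sx a L m K ℓ (fbOf hκ hLf b τ) y c)) * Fintype.card (Tbl L m κ₀) =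
        ∑ r : Rand L m κ₀, c₁ (psi a L m κ₀ r (Sx a L m K ℓ (fbOf hκ hLf b τ) y c)) := by
      intro c
      rw [sum_psi_eq hκ hL, mul_comm]
      unfold Sx; rw [Vsum_glue]
    simp only [hx]
    rw [Finset.sum_comm]
    calc ∑ r : Rand L m κ₀, ∑ c : Fin (K * ℓ) → Bool, c₁ (psi a L m κ₀ r (Sx a L m K ℓ (fbOf hκ hLf b τ) y c))
        ≤ ∑ _r : Rand L m κ₀, B := Finset.sum_le_sum fun r _ => by
          rw [hc₁]; dsimp only
          rw [← natCast_card_filter]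
          exact card_structured_le hκ hκ0 haW hk (by omega) hℓ hW (fbOf_mem hκ hLf b τ) y hg r
      _ = (Fintype.card (Rand L m κ₀) : ℝ) * B := by rw [sum_const, card_univ, nsmul_eq_mul]
  -- summing over `τ` re-indexes the translations
  have hsum : ∑ τ : ZMod 3, ∑ c : Fin (K * ℓ) → Bool,
      Vsum a L m κ₀ c₁ y (Pwin a L m κ₀ (Sx a L m K ℓ (fbOf hκ hLf b τ) y c)) =
      (2 : ℝ) ^ (K * ℓ) * ∑ t : ZMod 3, Vsum a L m κ₀ c₁ y (affP b t) := by
    rw [Finset.sum_comm]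
    have : ∀ c : Fin (K * ℓ) → Bool, ∑ τ : ZMod 3,
        Vsum a L m κ₀ c₁ y (Pwin a L m κ₀ (Sx a L m K ℓ (fbOf hκ hLf b τ) y c)) =
        ∑ t : ZMod 3, Vsum a L m κ₀ c₁ y (affP b t) := by
      intro c
      simp only [Pwin_Sx hκ0 haW hW (fbOf_mem hκ hLf b _) y c]
      exact Equiv.sum_comp (Equiv.addLeft (κ₀ * ∑ j ∈ range K, gsign ℓ (cbOf K ℓ c j)))
        (fun t => Vsum a L m κ₀ c₁ y (affP b t))
    simp only [this, sum_const, card_univ, Fintype.card_fun, Fintype.card_bool, Fintype.card_fin, nsmul_eq_mul]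
    push_cast; ring
  have htot := Finset.sum_le_sum fun τ (_ : τ ∈ (univ : Finset (ZMod 3))) => hτ τ
  rw [← Finset.sum_mul, hsum, sum_const, card_univ, ZMod.card, nsmul_eq_mul, card_Rand] at htot
  push_cast at htot
  -- divide by `2^{Kℓ}·#Tbl`
  have h2 : (0 : ℝ) < (2 : ℝ) ^ (K * ℓ) := by positivity
  have key : ∑ t : ZMod 3, Vsum a L m κ₀ c₁ y (affP b t) ≤ 3 * (6 : ℝ) ^ m * B / (2 : ℝ) ^ (K * ℓ) := by
    rw [le_div_iff₀ h2]
    have := htot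
    nlinarith
  refine le_trans key (le_of_eq ?_)
  rw [hB]; field_simp; ring

end StructuredBound

end DWalk

end Summit.QuantumAdvantage.AdviceFreeQNC0

end
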